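import Summits.AtomisticToContinuum.Crystallization.Theorems.ExcessDecayLiouvillePhononStabilityCertNode
import Summits.AtomisticToContinuum.Crystallization.Theorems.ExcessDecayLiouvillePhononStabilityCertChargeAccD
import Summits.AtomisticToContinuum.Crystallization.Theorems.ExcessDecayLiouvillePhononStabilityCertNear
import Summits.AtomisticToContinuum.Crystallization.Theorems.ExcessDecayLiouvillePhononStabilityCertCover

/-!
# Near-certificate layer V7-a (part 1, root box constants and the class link): the true finite-range form dominates the model form on the root chart (lead c2)

Support file for crux `PhononStability` (stmt-AtomisticToContinuum-9333), line `contragredient-window-collapse`.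

For the root chart `rootCell` (`…CertCover.lean`) and its exact inverse metric `Hc`, the model data of the vertex
scheme are assembled from the EXISTING chart polynomials: per non-diagonal near class
`⟨c, ρ̄_c, rhoPolyGen, LmatP, lowMatL Hc, U_c, U_c⁻¹⟩` (`classDatOf`), the affine part (metric `−2κ` terms in the affine
metric model, the constant majorant corrections, the `N₀` charge) and the convex part (accumulated far charges,
`accLmatP`).  The link inequalities: `classTerm ≥ classModel − Ψ_c (200/189)² P_c(M⁺)` (`classTerm_ge`),
`metricForm ≤ P_c(Λ(x)) + (200/189)² P_c(M⁺)` (`metricForm_le`), whence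
`Fmodel(chartX)(w) ≤ Σ_{classesR} classTerm − 2κ Σ_nn metricForm − accVal − K·N₀` (`Fmodel_le_true`).
-/

noncomputable section

open scoped BigOperators Matrix
open Set Function
open Summit.AtomisticToContinuum.Crystallization.Theorems.PhononStabilityNegative
open Summit.AtomisticToContinuum.Crystallization.Theorems.PhononStabilityCWC.FarControlStub

namespace Summit.AtomisticToContinuum.Crystallization.Theorems.PhononStabilityCWC.Cert

local notation "E3" => EuclideanSpace ℝ (Fin 3)

/-! ## The root box as a box of intervals; the `ψ̃`-negativity constants -/

/-- the root box of the chart variables `1 … 15` (all other variables vanish at the chart assignment) -/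
def rootBoxN : Box := fun v => if 1 ≤ v ∧ v ≤ 15 then ⟨-rootH v, rootH v⟩ else ⟨0, 0⟩

/-- the strain half-widths of the root box -/
def rootHs : Fin 6 → ℚ := fun v => rootH (v.val + 1)

section Window

variable {A B : E3 →L[ℝ] E3} {δ : E3} (hW : CellWindow A) (hδ : ShiftWindow A δ)
include hW hδ

/-- the chart assignment of a window datum lies in the root box. [folklore] -/
theorem mem_rootBoxN : rootBoxN.mem (chartX rootCell A B δ) := by
  intro v
  unfold rootBoxN
  by_cases hv : 1 ≤ v ∧ v ≤ 15
  · rw [if_pos hv]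
    have h := root_box (B := B) hW hδ v hv.1 hv.2
    rw [abs_le] at h
    exact ⟨by push_cast; exact h.1, by push_cast; exact h.2⟩
  · rw [if_neg hv]
    have h0 : chartX rootCell A B δ v = 0 := by
      unfold chartX; rw [if_neg hv]
    rw [h0]; exact ⟨by simp, by simp⟩

/-- the strain box bound in the form used by the majorant lemma. [folklore] -/
theorem strain_box (v : Fin 6) : |chartX rootCell A B δ (sv v)| ≤ rootHs v := by
  have := root_box (B := B) hW hδ (sv v) (by simp [sv]) (by simp [sv]; omega)
  simpa [rootHs, sv] using this

end Window

/-- the `ψ̃`-negativity constant of a class over the root box: `Ψ_c ≥ (−ψ̃(ρ_c))₊` -/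
def psiNeg (c : BondClass) : ℚ :=
  max 0 (-(phiIvls (rhoIvl (rootCell.rhoc c) (rhoPolyGen rootCell c) rootBoxN)).2.2.2.1.lo)

/-- positivity of the `ρ`-interval of a class over the root box (a `Bool` check) -/
def rhoPosRoot (c : BondClass) : Bool := decide (0 < (rhoIvl (rootCell.rhoc c) (rhoPolyGen rootCell c) rootBoxN).lo)

/-- `−Ψ_c ≤ ψ̃(ρ_c)` on the window. [folklore] -/
theorem neg_psiNeg_le {A B : E3 →L[ℝ] E3} {δ : E3} (hW : CellWindow A) (hδ : ShiftWindow A δ) {c : BondClass}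
    (hpos : rhoPosRoot c = true) :
    -(psiNeg c : ℝ) ≤ psiT ((rootCell.rhoc c : ℝ) + spEval (rhoPolyGen rootCell c) (chartX rootCell A B δ)) := by
  unfold rhoPosRoot at hpos
  simp only [decide_eq_true_eq] at hpos
  have hm := mem_rhoIvl (rootCell.rhoc c) (rhoPolyGen rootCell c) (mem_rootBoxN (B := B) hW hδ)
  obtain ⟨-, -, -, h4, -, -⟩ := mem_phiIvls hpos hm
  have hlo := h4.1
  unfold psiNeg
  push_cast
  have : -(max (0 : ℝ) (-((phiIvls (rhoIvl (rootCell.rhoc c) (rhoPolyGen rootCell c) rootBoxN)).2.2.2.1.lo : ℝ)))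
      ≤ ((phiIvls (rhoIvl (rootCell.rhoc c) (rhoPolyGen rootCell c) rootBoxN)).2.2.2.1.lo : ℝ) := by
    have := le_max_right (0 : ℝ) (-((phiIvls (rhoIvl (rootCell.rhoc c) (rhoPolyGen rootCell c) rootBoxN)).2.2.2.1.lo : ℝ))
    linarith
  exact this.trans hlo

/-! ## The class link -/

/-- `(200/189)²`, the window constant of the PSD part -/
def Kwin : ℚ := (200 / 189) ^ 2

section Link

variable {A B : E3 →L[ℝ] E3} {δ : E3} (hW : CellWindow A) (hδ : ShiftWindow A δ) (hAB : Contragredient A B)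
variable {Hc : Mat} (hHG : matEqB (mmul Hc rootCell.G) oneQ = true) (hGH : matEqB (mmul rootCell.G Hc) oneQ = true)
  (hHs : matEqB (mtrans Hc) Hc = true)
include hW hδ hAB hHG hGH hHs

omit hHG in
/-- the PSD part of the metric pair form is squeezed between `0` and `(200/189)² P_c(M⁺)`. [folklore] -/
theorem psdPart_bounds (c : BondClass) {w : Label → E3} (hw : (support w).Finite) :
    0 ≤ pairEvalR c (psdMat A B (castMat Hc)) w ∧
      pairEvalR c (psdMat A B (castMat Hc)) w ≤ (Kwin : ℝ) * pairEvalR c (castMat (majConst Hc rootHs)) w := by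
  have hHcT : (castMat Hc)ᵀ = castMat Hc := castMat_transpose_eq hHs
  have h1 : castMat rootCell.G * castMat Hc = 1 := castMat_mul_eq_one hGH
  refine ⟨pairEvalR_psd_nonneg A B hHcT c w, ?_⟩
  have hle := pairEvalR_psd_le hW hAB h1 hHcT c hw
  have hmaj := pairEvalR_majMat_le rootCell Hc rootHs A B δ (strain_box (B := B) hW hδ) c hw
  have hK : (0 : ℝ) ≤ (200 / 189) ^ 2 := by positivity
  unfold Kwin; push_cast
  exact hle.trans (mul_le_mul_of_nonneg_left hmaj hK)

/-- **THE METRIC LINK:** `metricForm ≤ P_c(Λ(x)) + (200/189)² P_c(M⁺)`. [folklore] -/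
theorem metricForm_le (c : BondClass) {w : Label → E3} (hw : (support w).Finite) :
    metricForm B c w ≤ pairEvalR c (matVal (chartX rootCell A B δ) (lowMatL Hc)) w
      + (Kwin : ℝ) * pairEvalR c (castMat (majConst Hc rootHs)) w := by
  have h2 : castMat Hc * castMat rootCell.G = 1 := castMat_mul_eq_one hHG
  rw [chartIdentities.2.2.2.1 B c w, pairEvalR_hhat_split hAB h2 c hw]
  have hlow : (lowMat A (castMat rootCell.G) (castMat Hc) : Fin 3 → Fin 3 → ℝ)
      = matVal (chartX rootCell A B δ) (lowMatL Hc) := by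
    funext i j; exact (matVal_lowMatL rootCell Hc A B δ i j).symm
  rw [hlow]
  have := (psdPart_bounds (B := B) (δ := δ) hW hδ hAB hGH hHs c hw).2
  linarith

omit hHG in
/-- the metric pair form is nonnegative, hence so is `P_c(M⁺)` whenever it matters: `0 ≤ (200/189)² P_c(M⁺)`. [folklore] -/
theorem majConst_term_nonneg (c : BondClass) {w : Label → E3} (hw : (support w).Finite) :
    0 ≤ (Kwin : ℝ) * pairEvalR c (castMat (majConst Hc rootHs)) w := by
  have h := psdPart_bounds (B := B) (δ := δ) hW hδ hAB hGH hHs c hw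
  linarith [h.1, h.2]

/-- **THE CLASS LINK:** `classTerm ≥ classModel − Ψ_c (200/189)² P_c(M⁺)` for a non-diagonal class with positive
`ρ`-interval. [folklore] -/
theorem classTerm_ge {c : BondClass} (hpos : rhoPosRoot c = true) {w : Label → E3} (hw : (support w).Finite) :
    classModel (rootCell.rhoc c) (rhoPolyGen rootCell c) (LmatP rootCell c) (lowMatL Hc) c (chartX rootCell A B δ) w
        - (psiNeg c : ℝ) * ((Kwin : ℝ) * pairEvalR c (castMat (majConst Hc rootHs)) w)
      ≤ classTerm A B δ w c := by
  set x := chartX rootCell A B δ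
  have hρ : ‖A (bondVec δ c)‖ ^ 2 = (rootCell.rhoc c : ℝ) + spEval (rhoPolyGen rootCell c) x := by
    rw [spEval_rhoPolyGen chartIdentities]; ring
  have hlong : longForm δ c w = pairEvalR c (matVal x (LmatP rootCell c)) w := by
    rw [longForm_eq_pairEvalR chartIdentities, matVal_LmatP]
  have h2 : castMat Hc * castMat rootCell.G = 1 := castMat_mul_eq_one hHG
  have hmetric : metricForm B c w = pairEvalR c (matVal x (lowMatL Hc)) w + pairEvalR c (psdMat A B (castMat Hc)) w := by
    rw [chartIdentities.2.2.2.1 B c w, pairEvalR_hhat_split hAB h2 c hw]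
    congr 1
    congr 1
    funext i j; exact (matVal_lowMatL rootCell Hc A B δ i j).symm
  unfold classTerm classModel
  rw [omegaLJ_eq_omegaT, psiLJ_eq_psiT, hρ, hlong, hmetric]
  set ψ := psiT ((rootCell.rhoc c : ℝ) + spEval (rhoPolyGen rootCell c) x)
  set Pd := pairEvalR c (psdMat A B (castMat Hc)) w
  set Mj := (Kwin : ℝ) * pairEvalR c (castMat (majConst Hc rootHs)) w
  obtain ⟨hPd0, hPdM⟩ := psdPart_bounds (B := B) (δ := δ) hW hδ hAB hGH hHs c hw
  have hΨ : -(psiNeg c : ℝ) ≤ ψ := neg_psiNeg_le (B := B) hW hδ hpos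
  have hΨ0 : 0 ≤ (psiNeg c : ℝ) := by unfold psiNeg; push_cast; exact le_max_left _ _
  -- `ψ · Pd ≥ −Ψ · Mj`
  have key : -(psiNeg c : ℝ) * Mj ≤ ψ * Pd := by
    rcases le_total 0 ψ with hψ | hψ
    · have : 0 ≤ ψ * Pd := mul_nonneg hψ hPd0
      nlinarith
    · -- `ψ ≤ 0`: `ψ Pd ≥ ψ Mj ≥ −Ψ Mj`
      have h1 : ψ * Mj ≤ ψ * Pd := mul_le_mul_of_nonpos_left hPdM hψ
      have h2 : -(psiNeg c : ℝ) * Mj ≤ ψ * Mj := mul_le_mul_of_nonneg_right hΨ (by linarith)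
      linarith
  nlinarith [key]

end Link

/-- Anchor of this support file (registered stub of the line skeleton, lead c2): the window constant. -/
theorem stub_certLinkA : Kwin = (200 / 189) ^ 2 := by
  rfl

end Summit.AtomisticToContinuum.Crystallization.Theorems.PhononStabilityCWC.Cert

end
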